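import Summits.HubbardSuperconductivity.HubbardLadder.Bounds.SectorFourierProjection
import Summits.HubbardSuperconductivity.HubbardLadder.Bounds.ComplexFugacityOffArc
import HarnessLib

/-!
# The N-sector twist-insensitivity NUMERATOR bound (bounds.tex Theorem 13, N-sector form, step 1–3)

HONEST FRAMING (cell pub-hubbard): ladder R1–R4 with certified numbers; no claim on H/H₀. Bounds for
model classes (the seam-twisted translation-invariant `t–t'` Hubbard torus, canonical `N`-particle
sector), no materials claim. Imports only landed modules and parts F1 / F4 of this device
(`SectorFourierProjection` = LEAN FILING REQUEST #211.2, `ComplexFugacityOffArc` = #211.5, which carries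
F2, F3 and S).

This is part F8a of the kernel device for bounds.tex Theorem 13 in the N-sector form: the assembly of
the sector projection (F1), the on-arc complex-fugacity twist insensitivity (F3), the single-site
arc / off-arc inequalities (S) and the off-arc volume contraction (F4) into ONE kernel inequality for
the numerator `|Z_N(A_θ) - Z_N(0)|` of the canonical twist-insensitivity ratio, at an arbitrary real
base fugacity `s` — bounds.tex (13.1)–(13.3). The denominator side (centring of `s = s_N`, the ratio
walk `Z_N(0) ≥ π_B e^{-sN} Z^{gc}(0; s)/(2K-1)`; bounds.tex Lemmas 13.3–13.5) is NOT in this file.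

DEFINITIONS. `atomicZ v s = 1 + 2e^{s} + e^{2s-v}` (the one-site partition function at real fugacity
`s`, `v = βU`), `atomicDensity v s = (2e^{s} + 2e^{2s-v})/atomicZ v s ∈ [0,2]`, and the off-arc rate
`offArcRate c₀ u₀ v s = (1-c₀) · n(2-n) / ((1+e^{u₀})(1+e^{u₀/2}))`, `n = atomicDensity v s` (part S).

THEOREMS (0 sorry; `L ≥ 3`, real `β ≠ 0`, `t', U, θ`).
* `norm_Zc_ttFluxCoupling_le_norm_Zc_re` — positivity: `‖Zc(β,U,ζ/β; c_θ)‖ ≤ ‖Zc(β,U,(Re ζ)/β; c_θ)‖`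
  (the Gibbs weight of the Hermitian twisted torus has a nonnegative diagonal, so the fugacity sum is
  dominated termwise by the one at the real part of the fugacity).
* `norm_cexp_neg_mul_fourierPoint` — `|e^{-Nζ_k}| = e^{-sN}` on the circle `ζ_k = s + 2πik/M`.
* **`norm_partitionFn_toBlock_card_twist_sub_le`** — for `M > |Orb Λ_L|`, `N < M`, a real base point
  `s` with `z₀(β,U,ζ_k/β) ≠ 0` at the `M` Fourier points, arc data `0 ≤ c₀ ≤ 1`, `|βU| ≤ u₀`, `R > 0` with
  `1 ≤ R²(1 - (1-c₀)/2 - (1-c₀²)/(1+e^{-u₀/2})²)`, Kotecký–Preiss data `a, δ > 0` with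
  `16 σ e^{2σ} (R e^{a+δ} + a)² ≤ a` (`σ = |β|(1+|t'|)`) and off-arc data `F` with
  `e^{κ} + 16 σ e^{2σ} F² ≤ F` (`κ = offArcRate c₀ u₀ (βU) s`):
  `‖Z_N(θ) - Z_N(0)‖ ≤ e^{-sN} · ( ‖Zc(β,U,s/β; c_0)‖ · (exp(2aL² e^{-δL}) - 1)
                              + 2 · atomicZ(βU, s)^{|Λ_L|} · exp((F - e^{κ} - κ)|Λ_L|) )`,
  where `Z_N(θ) = partitionFn β (H^{tt'}_L(θ)|_{#s = N})`. The first term is the ARC contribution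
  ((13.2): relative error `e^{ε_L} - 1`, `ε_L = 2aL²e^{-δL}`, against the real grand-canonical partition
  function at fugacity `s`), the second the OFF-ARC contribution ((13.3): absolutely small by the volume
  factor `e^{-(κ - (F - e^{κ}))|Λ_L|}`); the arc fractions `#arc/M, #off/M ≤ 1` are not tracked.

References: bounds.tex §13 ((13.1)–(13.3), Lemmas 13.1–13.2); D. Ueltschi, J. Stat. Phys. 95 (1999)
693, §2.3 [Ueltschi1999]; R. Kotecký, D. Preiss, Comm. Math. Phys. 103 (1986) 491 [KoteckyPreiss1986].
-/

noncomputable section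

namespace Summit.HubbardSuperconductivity.HubbardLadder.Bounds

open Matrix Finset Complex
open Literature.MathematicalPhysics.QuantumLattice
open scoped ComplexOrder

/-! ### The one-site quantities at a real fugacity -/

/-- The one-site partition function at real fugacity `s` and `v = βU`: `z(v,s) = 1 + 2e^{s} + e^{2s-v}`.
[programme definition: bounds.tex §13, Lemma 13.1] -/
def atomicZ (v s : ℝ) : ℝ := 1 + 2 * Real.exp s + Real.exp (2 * s - v)

/-- The one-site density at real fugacity `s`: `n(v,s) = (2e^{s} + 2e^{2s-v}) / z(v,s)`.
[programme definition: bounds.tex §13, Lemma 13.2] -/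
def atomicDensity (v s : ℝ) : ℝ := (2 * Real.exp s + 2 * Real.exp (2 * s - v)) / atomicZ v s

/-- The off-arc contraction rate of part S: `κ(c₀,u₀,v,s) = (1-c₀) n(2-n) / ((1+e^{u₀})(1+e^{u₀/2}))`,
`n = atomicDensity v s`. [programme definition: bounds.tex §13, Lemma 13.2 (`κ₁`)] -/
def offArcRate (c₀ u₀ v s : ℝ) : ℝ :=
  (1 - c₀) * (atomicDensity v s * (2 - atomicDensity v s)) / ((1 + Real.exp u₀) * (1 + Real.exp (u₀ / 2)))

/-- `z(v,s) > 0`. [folklore] -/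
theorem atomicZ_pos (v s : ℝ) : 0 < atomicZ v s := by unfold atomicZ; positivity

/-- `0 ≤ n(v,s)`. [folklore] -/
theorem atomicDensity_nonneg (v s : ℝ) : 0 ≤ atomicDensity v s := by
  unfold atomicDensity; exact div_nonneg (by positivity) (atomicZ_pos v s).le

/-- `n(v,s) ≤ 2`. [folklore] -/
theorem atomicDensity_le_two (v s : ℝ) : atomicDensity v s ≤ 2 := by
  unfold atomicDensity
  rw [div_le_iff₀ (atomicZ_pos v s)]
  unfold atomicZ
  nlinarith [Real.exp_pos s, Real.exp_pos (2 * s - v)]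

/-- `0 ≤ κ(c₀,u₀,v,s)` for `c₀ ≤ 1`. [folklore] -/
theorem offArcRate_nonneg {c₀ : ℝ} (hc1 : c₀ ≤ 1) (u₀ v s : ℝ) : 0 ≤ offArcRate c₀ u₀ v s := by
  unfold offArcRate
  refine div_nonneg (mul_nonneg (by linarith) (mul_nonneg (atomicDensity_nonneg v s)
    (by linarith [atomicDensity_le_two v s]))) (by positivity)

/-! ### The Fourier circle through a real base point -/

/-- The real part of `ζ_k = s + 2πik/M` is `s`. [folklore] -/
theorem fourierPoint_ofReal_re (M : ℕ) (s : ℝ) (k : ℕ) : (fourierPoint M (s : ℂ) k).re = s := by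
  unfold fourierPoint
  simp [Complex.add_re, Complex.div_re, Complex.mul_re, Complex.mul_im]

/-- `|e^{-Nζ_k}| = e^{-sN}` on the circle through the real base point `s`. [folklore] -/
theorem norm_cexp_neg_mul_fourierPoint (M N : ℕ) (s : ℝ) (k : ℕ) :
    ‖cexp (-(N * fourierPoint M (s : ℂ) k))‖ = Real.exp (-(s * N)) := by
  rw [Complex.norm_exp, Complex.neg_re, ← Complex.ofReal_natCast, Complex.re_ofReal_mul,
    fourierPoint_ofReal_re, mul_comm]

/-! ### Positivity: the fugacity sum is dominated by the one at the real part -/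

section Torus

variable {L : ℕ} [NeZero L]

/-- **Positivity.** For `L ≥ 3`, `β ≠ 0` and every twist `θ`:
`‖Zc(β,U,ζ/β; c_θ)‖ ≤ ‖Zc(β,U,(Re ζ)/β; c_θ)‖` — by part F1's dictionary both sides are fugacity sums
`Σ_s e^{ζ|s|} (e^{-βH_θ})_{ss}` over Fock basis states, and the diagonal of the Gibbs weight of the
Hermitian `H_θ` is nonnegative. [folklore; this file] -/
theorem norm_Zc_ttFluxCoupling_le_norm_Zc_re (hL : 3 ≤ L) {β : ℝ} (hβ : β ≠ 0) (t' U θ : ℝ) (ζ : ℂ) :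
    ‖Zc (β : ℂ) (U : ℂ) (ζ / β) (ttFluxCoupling L β t' θ)‖ ≤
      ‖Zc (β : ℂ) (U : ℂ) ((ζ.re : ℂ) / β) (ttFluxCoupling L β t' θ)‖ := by
  rw [← trace_fugacity_mul_gibbsWeight_hubbardTorusTT'Flux_eq_Zc hL hβ t' U θ ζ,
    ← trace_fugacity_mul_gibbsWeight_hubbardTorusTT'Flux_eq_Zc hL hβ t' U θ (ζ.re : ℂ)]
  set G := gibbsWeight β (hubbardTorusTT'Flux L t' U θ) with hG
  have hpsd : G.PosSemidef :=
    (Matrix.posDef_gibbsWeight β (isHermitian_hubbardTorusTT'Flux L t' U θ)).posSemidef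
  have hdiag : ∀ x, G x x = (((G x x).re : ℝ) : ℂ) ∧ 0 ≤ (G x x).re := by
    intro x
    obtain ⟨hre, him⟩ := Complex.nonneg_iff.1 (hpsd.diag_nonneg (i := x))
    exact ⟨Complex.ext (by simp) (by simp [← him]), hre⟩
  have htr : ∀ η : ℂ, ((diagonal fun x : Finset (Orb (FermionTorus 2 L)) => cexp (η * x.card)) * G).trace =
      ∑ x, cexp (η * x.card) * G x x := fun η => by
    simp [Matrix.trace, Matrix.diagonal_mul]
  rw [htr, htr]
  have hterm : ∀ x : Finset (Orb (FermionTorus 2 L)),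
      ‖cexp (ζ * x.card) * G x x‖ = Real.exp (ζ.re * x.card) * (G x x).re := by
    intro x
    rw [norm_mul, Complex.norm_exp, (hdiag x).1, Complex.norm_real, Real.norm_eq_abs,
      abs_of_nonneg (by simpa using (hdiag x).2)]
    simp [Complex.mul_re]
  have hsum : ∑ x : Finset (Orb (FermionTorus 2 L)), cexp ((ζ.re : ℂ) * x.card) * G x x =
      ((∑ x : Finset (Orb (FermionTorus 2 L)), Real.exp (ζ.re * x.card) * (G x x).re : ℝ) : ℂ) := by
    rw [Complex.ofReal_sum]
    refine Finset.sum_congr rfl fun x _ => ?_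
    rw [Complex.ofReal_mul, Complex.ofReal_exp, Complex.ofReal_mul, Complex.ofReal_natCast,
      ← (hdiag x).1]
  have hnn : 0 ≤ ∑ x : Finset (Orb (FermionTorus 2 L)), Real.exp (ζ.re * x.card) * (G x x).re :=
    Finset.sum_nonneg fun x _ => mul_nonneg (Real.exp_nonneg _) (hdiag x).2
  calc ‖∑ x : Finset (Orb (FermionTorus 2 L)), cexp (ζ * x.card) * G x x‖
      ≤ ∑ x, ‖cexp (ζ * x.card) * G x x‖ := norm_sum_le _ _
    _ = ∑ x, Real.exp (ζ.re * x.card) * (G x x).re := Finset.sum_congr rfl fun x _ => hterm x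
    _ = ‖∑ x : Finset (Orb (FermionTorus 2 L)), cexp ((ζ.re : ℂ) * x.card) * G x x‖ := by
        rw [hsum, Complex.norm_real, Real.norm_eq_abs, abs_of_nonneg hnn]

/-! ### The numerator bound -/

/-- **THEOREM (N-sector twist-insensitivity numerator; bounds.tex (13.1)–(13.3)).** See the module
docstring: for `L ≥ 3`, `β ≠ 0`, `M > |Orb Λ_L|`, `N < M`, a real base fugacity `s` with no zero of `z₀`
on the Fourier circle, arc data `(c₀, u₀, R)`, Kotecký–Preiss data `(a, δ)` and off-arc data `F`,
`‖Z_N(θ) - Z_N(0)‖ ≤ e^{-sN} (‖Z^{gc}(0; s)‖ (e^{ε_L} - 1) + 2 z(βU,s)^{|Λ_L|} e^{(F - e^{κ} - κ)|Λ_L|})`.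
[programme: bounds.tex §13, Theorem 13 N-sector form, numerator; this file] -/
theorem norm_partitionFn_toBlock_card_twist_sub_le (hL : 3 ≤ L) {β : ℝ} (hβ : β ≠ 0) (t' U θ : ℝ)
    {M N : ℕ} (hM : Fintype.card (Orb (FermionTorus 2 L)) < M) (hN : N < M) (s : ℝ)
    (hz : ∀ k ∈ Finset.range M, atomicPartitionFn (β : ℂ) (U : ℂ) (fourierPoint M (s : ℂ) k / β) ≠ 0)
    {c₀ u₀ R a δ F : ℝ} (hc₀ : 0 ≤ c₀) (hc1 : c₀ ≤ 1) (hv : |β * U| ≤ u₀) (hR : 0 < R)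
    (hfloor : 1 ≤ R ^ 2 * (1 - (1 - c₀) / 2 - (1 - c₀ ^ 2) / (1 + Real.exp (-(u₀ / 2))) ^ 2))
    (ha : 0 < a) (hδ : 0 < δ)
    (hsmall : 16 * (|β| * (1 + |t'|)) * Real.exp (2 * (|β| * (1 + |t'|))) *
      (R * Real.exp (a + δ) + a) ^ 2 ≤ a)
    (hF : Real.exp (offArcRate c₀ u₀ (β * U) s) +
      16 * (|β| * (1 + |t'|)) * Real.exp (2 * (|β| * (1 + |t'|))) * F ^ 2 ≤ F) :
    ‖partitionFn β ((hubbardTorusTT'Flux L t' U θ).toBlock (fun x => x.card = N) (fun x => x.card = N)) -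
        partitionFn β ((hubbardTorusTT'Flux L t' U 0).toBlock (fun x => x.card = N) (fun x => x.card = N))‖ ≤
      Real.exp (-(s * N)) *
        (‖Zc (β : ℂ) (U : ℂ) ((s : ℂ) / β) (ttFluxCoupling L β t' 0)‖ *
            (Real.exp (2 * a * (L : ℝ) ^ 2 * Real.exp (-(δ * L))) - 1) +
          2 * (atomicZ (β * U) s ^ Fintype.card (FermionTorus 2 L) *
            Real.exp ((F - Real.exp (offArcRate c₀ u₀ (β * U) s) - offArcRate c₀ u₀ (β * U) s) *
              Fintype.card (FermionTorus 2 L)))) := by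
  have hv' : -u₀ ≤ β * U := (abs_le.1 hv).1
  have hMpos : 0 < M := lt_of_le_of_lt (Nat.zero_le N) hN
  set ζ : ℕ → ℂ := fun k => fourierPoint M (s : ℂ) k with hζ
  have hre : ∀ k, (ζ k).re = s := fun k => fourierPoint_ofReal_re M s k
  set X := ‖Zc (β : ℂ) (U : ℂ) ((s : ℂ) / β) (ttFluxCoupling L β t' 0)‖ *
    (Real.exp (2 * a * (L : ℝ) ^ 2 * Real.exp (-(δ * L))) - 1) with hX
  set Y := 2 * (atomicZ (β * U) s ^ Fintype.card (FermionTorus 2 L) *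
    Real.exp ((F - Real.exp (offArcRate c₀ u₀ (β * U) s) - offArcRate c₀ u₀ (β * U) s) *
      Fintype.card (FermionTorus 2 L))) with hY
  have hε : 0 ≤ Real.exp (2 * a * (L : ℝ) ^ 2 * Real.exp (-(δ * L))) - 1 :=
    sub_nonneg.2 (Real.one_le_exp (by positivity))
  have hX0 : 0 ≤ X := mul_nonneg (norm_nonneg _) hε
  have hY0 : 0 ≤ Y := by have := atomicZ_pos (β * U) s; positivity
  -- off the arc: the volume contraction of part F4, at every twist
  have offarc : ∀ θ' : ℝ, ∀ w : ℂ, w.re = s → Real.cos w.im ≤ c₀ →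
      atomicPartitionFn (β : ℂ) (U : ℂ) (w / β) ≠ 0 →
      ‖Zc (β : ℂ) (U : ℂ) (w / β) (ttFluxCoupling L β t' θ')‖ ≤
        atomicZ (β * U) s ^ Fintype.card (FermionTorus 2 L) *
          Real.exp ((F - Real.exp (offArcRate c₀ u₀ (β * U) s) - offArcRate c₀ u₀ (β * U) s) *
            Fintype.card (FermionTorus 2 L)) := by
    intro θ' w hw hc hzw
    have h := norm_Zc_ttFluxCoupling_le_offarc hL hβ t' U θ' w c₀ u₀ hc hc1 hv hzw (F := F) ?_
    · rw [hw] at h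
      simpa only [atomicZ, atomicDensity, offArcRate] using h
    · rw [hw]
      simpa only [atomicZ, atomicDensity, offArcRate] using hF
  -- the bound at every Fourier point
  have hk : ∀ k ∈ Finset.range M,
      ‖Zc (β : ℂ) (U : ℂ) (ζ k / β) (ttFluxCoupling L β t' θ) -
          Zc (β : ℂ) (U : ℂ) (ζ k / β) (ttFluxCoupling L β t' 0)‖ ≤ X + Y := by
    intro k hkM
    have hzk := hz k hkM
    by_cases harc : c₀ ≤ Real.cos (ζ k).im
    · -- on the arc: part S bounds the site ratio, part F3 gives the relative twist insensitivity
      have hr : siteRatio (β : ℂ) (U : ℂ) (ζ k / β) ≤ R :=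
        siteRatio_le_of_arc β U hβ (ζ k) c₀ u₀ R hc₀ harc hv' hR hfloor
      have hr0 : 0 ≤ siteRatio (β : ℂ) (U : ℂ) (ζ k / β) := siteRatio_nonneg _ _ _
      have hsm : 16 * (|β| * (1 + |t'|)) * Real.exp (2 * (|β| * (1 + |t'|))) *
          (siteRatio (β : ℂ) (U : ℂ) (ζ k / β) * Real.exp (a + δ) + a) ^ 2 ≤ a := by
        refine le_trans (mul_le_mul_of_nonneg_left (pow_le_pow_left₀ (by positivity)
          (by nlinarith [Real.exp_pos (a + δ)]) 2) (by positivity)) hsmall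
      have h3 := norm_Zc_twist_sub_le_complexMu hL β t' U θ hzk ha hδ hsm
      have hpos := norm_Zc_ttFluxCoupling_le_norm_Zc_re hL hβ t' U 0 (ζ k)
      rw [hre k] at hpos
      calc ‖Zc (β : ℂ) (U : ℂ) (ζ k / β) (ttFluxCoupling L β t' θ) -
            Zc (β : ℂ) (U : ℂ) (ζ k / β) (ttFluxCoupling L β t' 0)‖
          ≤ ‖Zc (β : ℂ) (U : ℂ) (ζ k / β) (ttFluxCoupling L β t' 0)‖ *
              (Real.exp (2 * a * (L : ℝ) ^ 2 * Real.exp (-(δ * L))) - 1) := h3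
        _ ≤ X := mul_le_mul_of_nonneg_right hpos hε
        _ ≤ X + Y := le_add_of_nonneg_right hY0
    · -- off the arc: both Gibbs factors are small
      have hc : Real.cos (ζ k).im ≤ c₀ := (not_le.1 harc).le
      calc ‖Zc (β : ℂ) (U : ℂ) (ζ k / β) (ttFluxCoupling L β t' θ) -
            Zc (β : ℂ) (U : ℂ) (ζ k / β) (ttFluxCoupling L β t' 0)‖
          ≤ ‖Zc (β : ℂ) (U : ℂ) (ζ k / β) (ttFluxCoupling L β t' θ)‖ +
              ‖Zc (β : ℂ) (U : ℂ) (ζ k / β) (ttFluxCoupling L β t' 0)‖ := norm_sub_le _ _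
        _ ≤ Y := by
            have h1 := offarc θ (ζ k) (hre k) hc hzk
            have h2 := offarc 0 (ζ k) (hre k) hc hzk
            rw [hY]; linarith
        _ ≤ X + Y := le_add_of_nonneg_left hX0
  -- the Fourier projection of part F1 at both twists, same circle
  rw [partitionFn_toBlock_card_hubbardTorusTT'Flux_eq_fourier hL hβ t' U θ hM hN (s : ℂ),
    partitionFn_toBlock_card_hubbardTorusTT'Flux_eq_fourier hL hβ t' U 0 hM hN (s : ℂ), ← mul_sub,
    ← Finset.sum_sub_distrib, norm_mul, norm_inv, Complex.norm_natCast]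
  have hsum : ‖∑ k ∈ Finset.range M, (cexp (-(N * fourierPoint M (s : ℂ) k)) *
        Zc (β : ℂ) (U : ℂ) (fourierPoint M (s : ℂ) k / β) (ttFluxCoupling L β t' θ) -
      cexp (-(N * fourierPoint M (s : ℂ) k)) *
        Zc (β : ℂ) (U : ℂ) (fourierPoint M (s : ℂ) k / β) (ttFluxCoupling L β t' 0))‖ ≤
      M * (Real.exp (-(s * N)) * (X + Y)) := by
    refine (norm_sum_le _ _).trans ?_
    have hterm : ∀ k ∈ Finset.range M, ‖cexp (-(N * fourierPoint M (s : ℂ) k)) *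
          Zc (β : ℂ) (U : ℂ) (fourierPoint M (s : ℂ) k / β) (ttFluxCoupling L β t' θ) -
        cexp (-(N * fourierPoint M (s : ℂ) k)) *
          Zc (β : ℂ) (U : ℂ) (fourierPoint M (s : ℂ) k / β) (ttFluxCoupling L β t' 0)‖ ≤
        Real.exp (-(s * N)) * (X + Y) := by
      intro k hkM
      rw [← mul_sub, norm_mul, norm_cexp_neg_mul_fourierPoint]
      exact mul_le_mul_of_nonneg_left (hk k hkM) (Real.exp_nonneg _)
    refine (Finset.sum_le_sum hterm).trans ?_
    rw [Finset.sum_const, Finset.card_range, nsmul_eq_mul]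
  have hMr : (0 : ℝ) < M := by exact_mod_cast hMpos
  calc (M : ℝ)⁻¹ * ‖∑ k ∈ Finset.range M, (cexp (-(N * fourierPoint M (s : ℂ) k)) *
          Zc (β : ℂ) (U : ℂ) (fourierPoint M (s : ℂ) k / β) (ttFluxCoupling L β t' θ) -
        cexp (-(N * fourierPoint M (s : ℂ) k)) *
          Zc (β : ℂ) (U : ℂ) (fourierPoint M (s : ℂ) k / β) (ttFluxCoupling L β t' 0))‖
      ≤ (M : ℝ)⁻¹ * (M * (Real.exp (-(s * N)) * (X + Y))) :=
        mul_le_mul_of_nonneg_left hsum (by positivity)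
    _ = Real.exp (-(s * N)) * (X + Y) := by field_simp

end Torus

end Summit.HubbardSuperconductivity.HubbardLadder.Bounds

end
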